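import Mathlib
import Summits.ValiantsHypothesis.ValiantsHypothesis.Theorems.FifoMatchingNNDivisionHardZonotopeTransport
import Summits.ValiantsHypothesis.ValiantsHypothesis.Theorems.FifoMatchingNNDivisionHardFewSummandsLaw
import HarnessLib

/-!
# The K1/AFHMS transport of `Newt(NN_n) + Σ_i Q_i` for a MINKOWSKI SUM OF SMALL POLYTOPES, WITH the number and size of the summands
# (crux `Theses.FifoMatching.NNDivisionHard`, stmt-ValiantsHypothesis-21181; the few-summands law in the NN currency, part 1)

WHAT IS NEW.  ✓ `…FewSummandsLaw.summands_decided` decides, at the COR level, Minkowski passengers with `M` summands of `m` listed points,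
`(M·m²)·C(h−t−1,t−1) < C(h−1,t−1)`, ARBITRARY point sets.  This file carries the structure «`range q` = a product family
`{w + Σ_i vtx i (f i) : f : [M] → [m]}`» through the located-face transport (as ✓ `…ZonotopeTransport` did for subset-sum families):
a face of a Minkowski sum is the sum of the summands' faces (`prodFamily_face`: each summand restricted — by a retraction, keeping `m`
listed points — to its own maximisers), a linear image of a sum is the sum of the images:

* ★ `prodFamily_face`, `map_prodFamily`; `transport_step_prod`, ★ `transport_geometric_prod`;
* ★★ `nn_prod_fewSummands` — THE FEW-SUMMANDS LAW READ ON `NN_n` (explicit form): for `r ≥ 1`, `n ≥ (r+1)(2r+1)`, `2g ≤ r`, `g ≥ t₀`, every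
  cofactor-side passenger `conv{w + Σ_i vtx i (f i)}` (`M` summands, `m ≥ 1` points each) and every size-`s` EF of `Newt(NN_n) + Q`: some
  `h ≥ c·g` has, for all `C, t` with `1 ≤ t`, `(2(log₂h+C)^C+4)·t ≤ h`, `(M·m²)·C(h−t−1,t−1) < C(h−1,t−1)`: `2^((log₂ h+C)^C) < s`.

The route-rate corollary (products `Π_{i<M} p_i` of factors with `|supp p_i| ≤ m`, `M·m² ≤ n^k`, ANY degrees) is the sibling
`…NNDivisionHardFewSummandsProducts`.

HONEST FRAMING: transport lemmas toward a restriction theorem, NOT the crux: stmt-21181 `NNDivisionHard` OPEN; COR-VIRTUAL OPEN; `NNNotVP` OPEN;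
`VP ≠ VNP` NOT proved.  No definitions, no named facts, no sorry.  References: Fiorini et al. 2015 Lemma 9 [FioriniEtAl2015]; Kaibel–Weltge 2015
[KaibelWeltge2014]; AFHMS 2019 [AboulkerEtAl2019].
-/

set_option autoImplicit false

-- the mandated summit-side namespace repeats a component by design (single-problem summit)
set_option linter.dupNamespace false

noncomputable section

open Matrix Finset
open scoped Pointwise

namespace Summit.ValiantsHypothesis.ValiantsHypothesis.Theorems.FifoMatching

namespace Summands

open Literature.Barriers.PneNP (HasEFOfSize sum_dotProduct_le_sum_of_valid inter_eqs_eq_inter_sum_of_valid)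
open Literature.Combinatorics.Optimization (corPolytopeGraph)
open Summit.ValiantsHypothesis.ValiantsHypothesis.Theorems.FifoMatching.XcDivision
open Summit.ValiantsHypothesis.ValiantsHypothesis.Theorems.FifoMatching.LowDim (newt_inter_zeroSet_eq)
open MvPolynomial
open scoped NNReal
open Literature.Computability.AlgebraicComplexity (complexity nestFreeMatchingPoly)
open Literature.Algebra.Polynomial.NewtonPolytope (newtonPolytope newtonPolytope_mul)
open Summit.ValiantsHypothesis.ValiantsHypothesis.Theorems.FifoMatching.QueueGridFace
  (realOf suppPts newt QGV patternVec queueGridPP corMap corMap_image_queueGridPP newt_nonneg)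
open Summit.ValiantsHypothesis.ValiantsHypothesis.Theorems.FifoMatching.GridCorShadow (queueGridZeroOnePoints_holds)
open Summit.ValiantsHypothesis.ValiantsHypothesis.Theorems.FifoMatching.MonomialCofactor (newt_eq_newtonPolytope)
open Literature.Combinatorics.Optimization (AboulkerEtAl2019_gridCorCliqueFace)

/-! ## §1 Faces and linear images of product families -/

/-- ★ **the face of a Minkowski sum is the sum of the faces**, product-family form: the maximisers of `φ` over
`{w + Σ_i vtx i (f i) : f}` are the product family of the summands' maximisers — written with `m` listed points per summand again
(each summand composed with a retraction onto its maximisers). [folklore] -/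
theorem prodFamily_face {ι : Type} [Fintype ι] {M m : ℕ} (hm : 1 ≤ m) (vtx : Fin M → Fin m → ι → ℝ) (w : ι → ℝ) (φ : ι → ℝ) :
    ∃ (vtx' : Fin M → Fin m → ι → ℝ) (δ : ℝ),
      (∀ f : Fin M → Fin m, φ ⬝ᵥ (w + ∑ i, vtx i (f i)) ≤ δ) ∧
      {x | x ∈ Set.range (fun f : Fin M → Fin m => w + ∑ i, vtx i (f i)) ∧ φ ⬝ᵥ x = δ} =
        Set.range (fun f : Fin M → Fin m => w + ∑ i, vtx' i (f i)) := by
  classical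
  haveI : Nonempty (Fin m) := ⟨⟨0, hm⟩⟩
  -- per summand: a maximiser `a i` and the maximal value
  have hmax : ∀ i : Fin M, ∃ a : Fin m, ∀ b, φ ⬝ᵥ vtx i b ≤ φ ⬝ᵥ vtx i a := fun i => by
    obtain ⟨a, -, ha⟩ := Finset.exists_max_image Finset.univ (fun b => φ ⬝ᵥ vtx i b) Finset.univ_nonempty
    exact ⟨a, fun b => ha b (Finset.mem_univ b)⟩
  choose a ha using hmax
  -- the retraction onto the maximisers
  let ret : Fin M → Fin m → Fin m := fun i b => if φ ⬝ᵥ vtx i b = φ ⬝ᵥ vtx i (a i) then b else a i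
  have hret_max : ∀ i b, φ ⬝ᵥ vtx i (ret i b) = φ ⬝ᵥ vtx i (a i) := by
    intro i b
    by_cases hb : φ ⬝ᵥ vtx i b = φ ⬝ᵥ vtx i (a i)
    · simp [ret, hb]
    · simp [ret, hb]
  have hret_id : ∀ i b, φ ⬝ᵥ vtx i b = φ ⬝ᵥ vtx i (a i) → ret i b = b := by
    intro i b hb; simp [ret, hb]
  set δ : ℝ := φ ⬝ᵥ w + ∑ i, φ ⬝ᵥ vtx i (a i) with hδ
  have hval : ∀ f : Fin M → Fin m, φ ⬝ᵥ (w + ∑ i, vtx i (f i)) = φ ⬝ᵥ w + ∑ i, φ ⬝ᵥ vtx i (f i) := by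
    intro f; rw [dotProduct_add, dotProduct_sum]
  have hle : ∀ f : Fin M → Fin m, φ ⬝ᵥ (w + ∑ i, vtx i (f i)) ≤ δ := fun f => by
    rw [hval, hδ]
    have := Finset.sum_le_sum (s := Finset.univ) fun i _ => ha i (f i)
    linarith
  have heq : ∀ f : Fin M → Fin m, φ ⬝ᵥ (w + ∑ i, vtx i (f i)) = δ → ∀ i, φ ⬝ᵥ vtx i (f i) = φ ⬝ᵥ vtx i (a i) := by
    intro f hf
    rw [hval, hδ, add_right_inj] at hf
    exact (Finset.sum_eq_sum_iff_of_le fun i _ => ha i (f i)).1 hf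
      |> fun H i => H i (Finset.mem_univ i)
  refine ⟨fun i b => vtx i (ret i b), δ, hle, ?_⟩
  ext x
  simp only [Set.mem_setOf_eq, Set.mem_range]
  constructor
  · rintro ⟨⟨f, rfl⟩, hf⟩
    refine ⟨f, ?_⟩
    have hfix : ∀ i, ret i (f i) = f i := fun i => hret_id i (f i) (heq f hf i)
    simp only [hfix]
  · rintro ⟨f, rfl⟩
    refine ⟨⟨fun i => ret i (f i), rfl⟩, ?_⟩
    rw [hval, hδ]
    congr 1
    exact Finset.sum_congr rfl fun i _ => hret_max i (f i)

/-- linear images of product families are product families (same index sets). [folklore] -/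
theorem map_prodFamily {ι κ : Type} {M m : ℕ} (L : (ι → ℝ) →ₗ[ℝ] (κ → ℝ)) (vtx : Fin M → Fin m → ι → ℝ) (w : ι → ℝ)
    (f : Fin M → Fin m) : L (w + ∑ i, vtx i (f i)) = L w + ∑ i, (fun i b => L (vtx i b)) i (f i) := by
  rw [map_add, map_sum]

/-! ## §2 The transport WITH the number and size of the summands -/

/-- **ONE TRANSPORT STEP, with `(M, m)`**: as `Zono.transport_step_zono`, for product families. [cite: FioriniEtAl2015, Lemma 9] -/
theorem transport_step_prod {ι κ : Type} [Fintype ι] [Fintype κ] {M m : ℕ} (hm : 1 ≤ m)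
    {P : Set (ι → ℝ)} (vtx : Fin M → Fin m → ι → ℝ) (w : ι → ℝ) {r : ℕ}
    (h : HasEFOfSize (P + convexHull ℝ (Set.range fun f : Fin M → Fin m => w + ∑ i, vtx i (f i))) r)
    (φ : ι → ℝ) (δ : ℝ) (hP : ∀ x ∈ P, φ ⬝ᵥ x ≤ δ) (L : (ι → ℝ) →ₗ[ℝ] (κ → ℝ)) :
    ∃ (vtx' : Fin M → Fin m → κ → ℝ) (w' : κ → ℝ),
      HasEFOfSize (L '' (P ∩ {x | φ ⬝ᵥ x = δ}) +
        convexHull ℝ (Set.range fun f : Fin M → Fin m => w' + ∑ i, vtx' i (f i))) r := by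
  classical
  obtain ⟨vtx₁, δQ, hle, hface⟩ := prodFamily_face hm vtx w φ
  have hQ : ∀ y ∈ convexHull ℝ (Set.range fun f : Fin M → Fin m => w + ∑ i, vtx i (f i)), φ ⬝ᵥ y ≤ δQ :=
    dot_le_of_mem_convexHull _ φ _ (by rintro _ ⟨f, rfl⟩; exact hle f)
  have h2 := hasEFOfSize_image_add (h.face_add_face₁ φ δ δQ hP hQ) L
  rw [convexHull_range_inter_eq _ φ δQ hle, LinearMap.image_convexHull] at h2
  have hrange : Set.range (fun j : {f : Fin M → Fin m // φ ⬝ᵥ (w + ∑ i, vtx i (f i)) = δQ} =>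
      w + ∑ i, vtx i (j.1 i)) = Set.range (fun f : Fin M → Fin m => w + ∑ i, vtx₁ i (f i)) := by
    rw [← hface]
    ext x
    simp only [Set.mem_range, Set.mem_setOf_eq]
    constructor
    · rintro ⟨⟨f, hf⟩, rfl⟩
      exact ⟨⟨f, rfl⟩, hf⟩
    · rintro ⟨⟨f, rfl⟩, hx⟩
      exact ⟨⟨f, hx⟩, rfl⟩
  rw [hrange, ← Set.range_comp] at h2
  refine ⟨fun i b => L (vtx₁ i b), L w, ?_⟩
  have hcomp : (⇑L ∘ fun f : Fin M → Fin m => w + ∑ i, vtx₁ i (f i)) =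
      fun f : Fin M → Fin m => L w + ∑ i, (fun i b => L (vtx₁ i b)) i (f i) := by
    funext f
    exact map_prodFamily L vtx₁ w f
  rw [hcomp] at h2
  exact h2

/-- ★ **THE GEOMETRIC TRANSPORT WITH `(M, m)` (PROVED)**: for a Minkowski passenger `Q = conv{w + Σ_i vtx i (f i)}` of `Newt(NN_n)` with
`M` summands of `m ≥ 1` listed points: with AFHMS's constants `c, t₀`, for `r ≥ 1`, `n ≥ (r+1)(2r+1)`, `2g ≤ r`, `g ≥ t₀` and every
size-`s` extended formulation of `Newt(NN_n) + Q` there are `h ≥ c·g` and a passenger of `ℝ^{h×h}` of the same shape `(M, m)` with a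
size-`s` extended formulation of `COR(K_h) + Q'`. [cite: AboulkerEtAl2019, pp. 5–6 (grid-minor clique face)] [cite: FioriniEtAl2015, Lemma 9] -/
theorem transport_geometric_prod :
    ∃ c : ℝ, 0 < c ∧ ∃ t₀ : ℕ, ∀ (n r g : ℕ), 1 ≤ r → (r + 1) * (2 * r + 1) ≤ n → ∀ (hg : 2 * g ≤ r), t₀ ≤ g →
      ∀ {M m : ℕ}, 1 ≤ m → ∀ (vtx : Fin M → Fin m → (Fin (2 * n) × Fin (2 * n)) → ℝ)
        (w : (Fin (2 * n) × Fin (2 * n)) → ℝ) (s : ℕ),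
        HasEFOfSize (newt (nestFreeMatchingPoly n ℝ≥0) +
          convexHull ℝ (Set.range fun f : Fin M → Fin m => w + ∑ i, vtx i (f i))) s →
          ∃ h : ℕ, c * g ≤ h ∧ ∃ (vtx' : Fin M → Fin m → (Fin h × Fin h → ℝ)) (w' : Fin h × Fin h → ℝ),
            HasEFOfSize (corPolytopeGraph (⊤ : SimpleGraph (Fin h)) +
              convexHull ℝ (Set.range fun f : Fin M → Fin m => w' + ∑ i, vtx' i (f i))) s := by
  classical
  obtain ⟨c, hc, t₀, hface⟩ := AboulkerEtAl2019_gridCorCliqueFace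
  refine ⟨c, hc, t₀, fun n r g hr hn hg ht M m hm vtx w s hEF' => ?_⟩
  -- Step 1: the A1 coordinate face, read out onto `PP_r`
  obtain ⟨Z, f, hA1⟩ := queueGridZeroOnePoints_holds r n hr hn
  let φ : (Fin (2 * n) × Fin (2 * n)) → ℝ := fun e => if e ∈ Z then (-1 : ℝ) else 0
  have hφ : ∀ x : (Fin (2 * n) × Fin (2 * n)) → ℝ, φ ⬝ᵥ x = -∑ e ∈ Z, x e := by
    intro x
    simp only [dotProduct, φ, ite_mul, neg_one_mul, zero_mul]
    rw [Finset.sum_ite_mem, Finset.univ_inter, Finset.sum_neg_distrib]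
  have hP : ∀ x ∈ newt (nestFreeMatchingPoly n ℝ≥0), φ ⬝ᵥ x ≤ 0 := fun x hx => by
    rw [hφ]; exact neg_nonpos.2 (Finset.sum_nonneg fun e _ => newt_nonneg _ x hx e)
  let Lf : ((Fin (2 * n) × Fin (2 * n)) → ℝ) →ₗ[ℝ] ((QGV r × QGV r) × Bool × Bool → ℝ) :=
    LinearMap.funLeft ℝ ℝ f
  obtain ⟨vtx₁, w₁, h₁⟩ := transport_step_prod hm vtx w hEF' φ 0 hP Lf
  have hF : Lf '' (newt (nestFreeMatchingPoly n ℝ≥0) ∩ {x | φ ⬝ᵥ x = 0}) = queueGridPP r := by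
    rw [newt_inter_zeroSet_eq, LinearMap.image_convexHull]
    unfold queueGridPP
    congr 1
  rw [hF] at h₁
  -- Step 2: c1's coordinate-linear map onto `COR(G_g)`
  have h₂ := hasEFOfSize_image_add h₁ (corMap r g hg)
  rw [corMap_image_queueGridPP, LinearMap.image_convexHull, ← Set.range_comp,
    ← Summit.ValiantsHypothesis.ValiantsHypothesis.Theorems.FifoMatching.QueueGridFace.corPolytopeGraph_eq] at h₂
  have hcomp : (⇑(corMap r g hg) ∘ fun f : Fin M → Fin m => w₁ + ∑ i, vtx₁ i (f i)) =
      fun f : Fin M → Fin m => corMap r g hg w₁ + ∑ i, (fun i b => corMap r g hg (vtx₁ i b)) i (f i) := by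
    funext f
    exact map_prodFamily (corMap r g hg) vtx₁ w₁ f
  rw [hcomp] at h₂
  -- Step 3: AFHMS's face of `COR(G_g)` onto `COR(K_h)`, as ONE valid functional
  obtain ⟨h, hch, k, cv, δ, π, hvalid, hπ⟩ := hface g ht
  obtain ⟨vtx₃, w₃, h₃⟩ := transport_step_prod hm (fun i b => corMap r g hg (vtx₁ i b)) (corMap r g hg w₁) h₂
    (∑ i, cv i) (∑ i, δ i) (sum_dotProduct_le_sum_of_valid _ cv δ hvalid) π
  rw [← inter_eqs_eq_inter_sum_of_valid _ cv δ hvalid, hπ] at h₃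
  exact ⟨h, hch, vtx₃, w₃, h₃⟩

/-! ## §3 The FEW-SUMMANDS LAW read on `NN_n` (explicit form) -/

/-- ★★ **THE FEW-SUMMANDS LAW READ ON `NN_n` (explicit form, PROVED):** with AFHMS's constants `c, t₀`: for `r ≥ 1`,
`n ≥ (r+1)(2r+1)`, `2g ≤ r`, `g ≥ t₀`, every Minkowski passenger `Q = conv{w + Σ_i vtx i (f i)}` (`M` summands, `m ≥ 1` listed points each)
and every size-`s` extended formulation of `Newt(NN_n) + Q`, there is `h ≥ c·g` such that for all `C, t` with `1 ≤ t`,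
`(2(log₂ h + C)^C + 4)·t ≤ h` and `(M·m²)·C(h−t−1, t−1) < C(h−1, t−1)`: `2^((log₂ h + C)^C) < s`.
[cite: KaibelWeltge2014, Thm. 1] [cite: FioriniEtAl2015, Thm. 7] -/
theorem nn_prod_fewSummands :
    ∃ c : ℝ, 0 < c ∧ ∃ t₀ : ℕ, ∀ (n r g : ℕ), 1 ≤ r → (r + 1) * (2 * r + 1) ≤ n → 2 * g ≤ r → t₀ ≤ g →
      ∀ {M m : ℕ}, 1 ≤ m → ∀ (vtx : Fin M → Fin m → (Fin (2 * n) × Fin (2 * n)) → ℝ)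
        (w : (Fin (2 * n) × Fin (2 * n)) → ℝ) (s : ℕ),
        HasEFOfSize (newtonPolytope (MvPolynomial.map NNReal.toRealHom (nestFreeMatchingPoly n ℝ≥0)) +
          convexHull ℝ (Set.range fun f : Fin M → Fin m => w + ∑ i, vtx i (f i))) s →
          ∃ h : ℕ, c * g ≤ h ∧ ∀ (C t : ℕ), 1 ≤ t → (2 * (Nat.log 2 h + C) ^ C + 4) * t ≤ h →
            (M * (m * m)) * Nat.choose (h - t - 1) (t - 1) < Nat.choose (h - 1) (t - 1) →
              2 ^ ((Nat.log 2 h + C) ^ C) < s := by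
  obtain ⟨c, hc, t₀, H⟩ := transport_geometric_prod
  refine ⟨c, hc, t₀, fun n r g hr hn hg ht M m hm vtx w s hEF => ?_⟩
  have hEF' : HasEFOfSize (newt (nestFreeMatchingPoly n ℝ≥0) +
      convexHull ℝ (Set.range fun f : Fin M → Fin m => w + ∑ i, vtx i (f i))) s := by
    rw [newt_eq_newtonPolytope]; exact hEF
  obtain ⟨h, hch, vtx', w', hR⟩ := H n r g hr hn hg ht hm vtx w s hEF'
  refine ⟨h, hch, fun C t ht1 hht hcount => ?_⟩
  exact summands_decided C h t M m vtx' w' s ht1 hm hht hcount hR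

end Summands

end Summit.ValiantsHypothesis.ValiantsHypothesis.Theorems.FifoMatching

end
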